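import Mathlib
import Literature.Analysis.FluidPDE.Tao2016AveragedNS.ShiftSetCascadeFlows
import HarnessLib

/-!
# Certificate glue on a shift set `𝕊`, X: MESH SOUNDNESS — the trapping and landing clauses of the A♭
  window certificate from ONE-STEP enclosures along a time mesh and a section crossing
  (helper for item stmt-NavierStokesRegularity-22987 `FlatGapCertificatesV2`, crux K_A♭ of route
  TaoLadderRungTwoFlat; cell harvest/h2-tao-ladder, p1 g14)

The glue theorem `CertificateGlueOn.gapData₂On_of_windowCertificate` (glue IV) consumes three dynamical
clauses about the FINITE window system `[-Kb, Ka]` with two interval-valued edge inputs: `hinside` (static),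
`htrap` (an exact window trajectory from the fattened core with admissible inputs stays in the open `M`-box up
to the clock `c`) and `hland` (by the clock `c₀` it reads out: ratio `a`, matching core state, top acceptance,
bottom exit). Both dynamical clauses quantify over ALL families `S : Fin m → ℤ → ℝ → ℝ` solving the window
equations with ARBITRARY continuous bounded edge inputs — the objects a validated integrator encloses step by
step. This module is the format-free SOUNDNESS LAYER between the two:

* `WindowRun` — the run predicate (window equations on `[0,s]`, continuous edge inputs under the two bounds);
  it is invariant under time shifts (`WindowRun.shift`) and restriction (`WindowRun.mono`) — the inputs being
  arbitrary admissible functions, a shifted run is again a run;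
* a MESH CERTIFICATE: node predicates `Node j` and step hulls `Hull j` on a mesh `0 = t 0 < t 1 < … < t N`,
  the start inclusion (fattened core ⊆ `Node 0`) and ONE-STEP certificates `StepCert j` (every run of length
  `≤ t (j+1) - t j` from `Node j`, a priori in the closed `M`-box, stays in `Hull j` and ends in `Node (j+1)`) —
  exactly the shape a one-step validated enclosure (first-order Picard test, or a Taylor model with restart)
  delivers;
* `htrap_of_mesh` — mesh up to `c` + hulls inside the open `M`-box ⇒ the clause `htrap` VERBATIM;
* `hland_of_mesh` — mesh up to `t (ℓ+1) ≤ c₀`, a section functional continuous along runs that is `< lev` on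
  `Node ℓ` and `≥ lev` on `Node (ℓ+1)` (intermediate value theorem ⇒ a crossing time `τ₁ ∈ (t ℓ, t (ℓ+1)]`, per
  trajectory — a fixed readout time cannot close a recurrent box, the phase being neutral), and the STATIC
  readout clauses on `Hull ℓ ∩ {sec = lev}` ⇒ the clause `hland` VERBATIM;
* `continuousOn_abs_obs` — the observable modulus `y ↦ |y i₀ 1|` is an admissible section functional.

HONEST FRAMING: Tao-type MODEL lattices (Tao 2016 §4/§6 vocabulary, shift-set parametrised); the mesh
certificate is a HYPOTHESIS — nothing is computed or certified here, no stub is closed, and nothing here is a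
statement about the Navier–Stokes equations.
-/

noncomputable section

-- the sub-problem namespace repeats the summit name by design (D-0017)
set_option linter.dupNamespace false

namespace Summit.NavierStokesRegularity.NavierStokesRegularity.Theorems

open Set Filter Topology Literature.Analysis.FluidPDE Literature.Analysis.FluidPDE.TaoCascade

namespace CertificateGlueOn

variable {m : ℕ}

/-! ### Window runs -/

/-- **A WINDOW RUN on `[0, s]`** of the table `α` on the shift set `𝕊` at scale ratio `1+ε₀`, window
`[-Kb, Ka]`, edge-input bounds `Eb` (shell `-Kb-1`) and `Et` (shell `Ka+1`): the window amplitudes solve the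
exact equations `Ṡ_{i,k} = quadTermOn 𝕊 ε₀ α S i k` within `[0,s]`, the two edge shells are continuous inputs
bounded by `Eb`, `Et` (the hypotheses 5–9 of the clauses `htrap` / `hland` of glue IV).
[cite: Tao2016AveragedNS, §4 Lemma 4.1 (4.8) (equations of motion); cell vocabulary, window-truncated with edge inputs] -/
structure WindowRun (𝕊 : Finset (ℤ × ℤ × ℤ)) (ε₀ : ℝ) (α : Fin m → Fin m → Fin m → ℤ × ℤ × ℤ → ℝ)
    (Kb Ka : ℤ) (Eb Et s : ℝ) (S : Fin m → ℤ → ℝ → ℝ) : Prop where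
  /-- the window equations within `[0,s]` -/
  deriv : ∀ i k, -Kb ≤ k → k ≤ Ka → ∀ u ∈ Icc 0 s,
    HasDerivWithinAt (S i k) (quadTermOn 𝕊 ε₀ α S i k u) (Icc 0 s) u
  /-- the bottom input is continuous -/
  cont_bot : ∀ i, ContinuousOn (S i (-Kb - 1)) (Icc 0 s)
  /-- the top input is continuous -/
  cont_top : ∀ i, ContinuousOn (S i (Ka + 1)) (Icc 0 s)
  /-- the bottom input is bounded by `Eb` -/
  bound_bot : ∀ i, ∀ u ∈ Icc 0 s, |S i (-Kb - 1) u| ≤ Eb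
  /-- the top input is bounded by `Et` -/
  bound_top : ∀ i, ∀ u ∈ Icc 0 s, |S i (Ka + 1) u| ≤ Et

/-- The state of a family at time `u`. [cite: Tao2016AveragedNS, §4 (4.7); cell vocabulary] -/
def slice (S : Fin m → ℤ → ℝ → ℝ) (u : ℝ) : Fin m → ℤ → ℝ := fun i k => S i k u

/-- Unfolding `slice`. [cite: Tao2016AveragedNS, §4 (4.7); cell vocabulary] -/
@[simp] theorem slice_apply (S : Fin m → ℤ → ℝ → ℝ) (u : ℝ) (i : Fin m) (k : ℤ) :
    slice S u i k = S i k u := rfl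

/-- The state of a restarted family. [cite: Tao2016AveragedNS, §4 (4.7); cell vocabulary] -/
theorem slice_shift (S : Fin m → ℤ → ℝ → ℝ) (t₀ v : ℝ) :
    slice (fun i k u => S i k (t₀ + u)) v = slice S (t₀ + v) := rfl

variable {𝕊 : Finset (ℤ × ℤ × ℤ)} {ε₀ : ℝ} {α : Fin m → Fin m → Fin m → ℤ × ℤ × ℤ → ℝ} {Kb Ka : ℤ}
  {Eb Et : ℝ}

namespace WindowRun

/-- Restriction of a window run to a shorter clock. [cite: Tao2016AveragedNS, §4 Lemma 4.1 (4.8); cell vocabulary, window-truncated with edge inputs] -/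
theorem mono {s s' : ℝ} {S : Fin m → ℤ → ℝ → ℝ} (h : WindowRun 𝕊 ε₀ α Kb Ka Eb Et s S) (hs' : s' ≤ s) :
    WindowRun 𝕊 ε₀ α Kb Ka Eb Et s' S where
  deriv i k hk1 hk2 u hu :=
    (h.deriv i k hk1 hk2 u ⟨hu.1, hu.2.trans hs'⟩).mono (Icc_subset_Icc_right hs')
  cont_bot i := (h.cont_bot i).mono (Icc_subset_Icc_right hs')
  cont_top i := (h.cont_top i).mono (Icc_subset_Icc_right hs')
  bound_bot i u hu := h.bound_bot i u ⟨hu.1, hu.2.trans hs'⟩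
  bound_top i u hu := h.bound_top i u ⟨hu.1, hu.2.trans hs'⟩

/-- **Time-shift invariance**: the restart of a window run at a time `t₀ ∈ [0,s]` is a window run on
`[0, s - t₀]` (the window equations are autonomous and the shifted inputs are again admissible).
[cite: Tao2016AveragedNS, §4 Lemma 4.1 (4.8); cell vocabulary, window-truncated with edge inputs] -/
theorem shift {s t₀ : ℝ} {S : Fin m → ℤ → ℝ → ℝ} (h : WindowRun 𝕊 ε₀ α Kb Ka Eb Et s S) (ht₀ : 0 ≤ t₀) :
    WindowRun 𝕊 ε₀ α Kb Ka Eb Et (s - t₀) (fun i k u => S i k (t₀ + u)) where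
  deriv i k hk1 hk2 u hu := by
    have hmaps : MapsTo (fun u : ℝ => t₀ + u) (Icc 0 (s - t₀)) (Icc 0 s) := fun v hv =>
      ⟨by linarith [hv.1], by linarith [hv.2]⟩
    have hid : HasDerivWithinAt (fun u : ℝ => t₀ + u) 1 (Icc 0 (s - t₀)) u :=
      (hasDerivWithinAt_id u _).const_add t₀
    have hS := h.deriv i k hk1 hk2 (t₀ + u) (hmaps hu)
    have := hS.comp u hid hmaps
    simpa [Function.comp_def, quadTermOn] using this
  cont_bot i := (h.cont_bot i).comp (continuousOn_const.add continuousOn_id) fun v hv =>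
      ⟨by linarith [hv.1], by linarith [hv.2]⟩
  cont_top i := (h.cont_top i).comp (continuousOn_const.add continuousOn_id) fun v hv =>
      ⟨by linarith [hv.1], by linarith [hv.2]⟩
  bound_bot i u hu := h.bound_bot i (t₀ + u) ⟨by linarith [hu.1], by linarith [hu.2]⟩
  bound_top i u hu := h.bound_top i (t₀ + u) ⟨by linarith [hu.1], by linarith [hu.2]⟩

/-- Window coordinates of a run are continuous on `[0,s]`. [cite: Tao2016AveragedNS, §4 Lemma 4.1 (4.8); cell vocabulary, window-truncated with edge inputs] -/
theorem continuousOn {s : ℝ} {S : Fin m → ℤ → ℝ → ℝ} (h : WindowRun 𝕊 ε₀ α Kb Ka Eb Et s S) (i : Fin m)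
    {k : ℤ} (hk1 : -Kb ≤ k) (hk2 : k ≤ Ka) : ContinuousOn (S i k) (Icc 0 s) := fun u hu =>
  (h.deriv i k hk1 hk2 u hu).continuousWithinAt

end WindowRun

/-- The observable modulus `u ↦ |S i₀ 1 u|` is continuous along a window run (`1 ≤ Ka`, `0 ≤ Kb`): it is
an admissible SECTION FUNCTIONAL for `hland_of_mesh`. [cite: Tao2016AveragedNS, §6.4 Prop. 6.5 (the readout |X_{i₀,n+1}|); cell vocabulary] -/
theorem continuousOn_abs_obs {s : ℝ} {S : Fin m → ℤ → ℝ → ℝ} (h : WindowRun 𝕊 ε₀ α Kb Ka Eb Et s S)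
    (hKb : 0 ≤ Kb) (hKa : 1 ≤ Ka) (i₀ : Fin m) :
    ContinuousOn (fun u => (fun y : Fin m → ℤ → ℝ => |y i₀ 1|) (slice S u)) (Icc 0 s) := by
  simpa [slice] using (h.continuousOn i₀ (k := 1) (by omega) hKa).abs

/-! ### Mesh certificates -/

/-- **ONE-STEP CERTIFICATE of step `j`** (mesh `t`, node predicates `Node`, hulls `Hull`, sup bounds `M` on the
window): every window run of length `0 < s ≤ t (j+1) - t j` starting in `Node j` and lying a priori in the
closed `M`-box stays in `Hull j` on `[0,s]`, and ends in `Node (j+1)` when `s` is the full step. This is the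
statement a validated one-step enclosure (Picard test / Taylor model + restart) certifies.
[cite: Tao2016AveragedNS, §6.3–6.4 Props. 6.4–6.5 (statement shape of a renormalisation certificate); cell certificate format, mesh layer] -/
def StepCert (𝕊 : Finset (ℤ × ℤ × ℤ)) (ε₀ : ℝ) (α : Fin m → Fin m → Fin m → ℤ × ℤ × ℤ → ℝ)
    (Kb Ka : ℤ) (Eb Et : ℝ) (M : ℤ → ℝ) (t : ℕ → ℝ) (Node Hull : ℕ → (Fin m → ℤ → ℝ) → Prop)
    (j : ℕ) : Prop :=
  ∀ (s : ℝ) (S : Fin m → ℤ → ℝ → ℝ), 0 < s → s ≤ t (j + 1) - t j → Node j (slice S 0) →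
    WindowRun 𝕊 ε₀ α Kb Ka Eb Et s S →
    (∀ i k, -Kb ≤ k → k ≤ Ka → ∀ u ∈ Icc 0 s, |S i k u| ≤ M k) →
      (∀ u ∈ Icc 0 s, Hull j (slice S u)) ∧ (s = t (j + 1) - t j → Node (j + 1) (slice S s))

variable {M : ℤ → ℝ} {t : ℕ → ℝ} {Node Hull : ℕ → (Fin m → ℤ → ℝ) → Prop} {N : ℕ}

/-- **Mesh induction, nodes**: along a run on `[0,s]` from `Node 0` in the closed `M`-box, every mesh node
`t j ≤ s` (`j ≤ N`) is reached inside `Node j`. [cite: Tao2016AveragedNS, §6.3–6.4 (statement shape); cell certificate format, mesh layer] -/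
theorem node_of_mesh (ht0 : t 0 = 0) (hmono : ∀ j, j < N → t j < t (j + 1))
    (hstep : ∀ j, j < N → StepCert 𝕊 ε₀ α Kb Ka Eb Et M t Node Hull j)
    {s : ℝ} {S : Fin m → ℤ → ℝ → ℝ} (hrun : WindowRun 𝕊 ε₀ α Kb Ka Eb Et s S) (h0 : Node 0 (slice S 0))
    (hM : ∀ i k, -Kb ≤ k → k ≤ Ka → ∀ u ∈ Icc 0 s, |S i k u| ≤ M k) :
    ∀ j, j ≤ N → t j ≤ s → Node j (slice S (t j)) := by
  have htnn : ∀ j, j ≤ N → 0 ≤ t j := by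
    intro j hj
    induction j with
    | zero => rw [ht0]
    | succ j ih => exact (ih (by omega)).trans (hmono j (by omega)).le
  intro j hj
  induction j with
  | zero => intro _; rwa [ht0]
  | succ j ih =>
    intro hts
    have hjN : j < N := by omega
    have htj : t j < t (j + 1) := hmono j hjN
    have hj0 : 0 ≤ t j := htnn j hjN.le
    have hnode := ih hjN.le (htj.le.trans hts)
    -- restart the run at `t j` and apply the one-step certificate with the full step length
    have hshift := hrun.shift (t₀ := t j) hj0
    have hrun' : WindowRun 𝕊 ε₀ α Kb Ka Eb Et (t (j + 1) - t j) (fun i k u => S i k (t j + u)) :=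
      hshift.mono (by linarith)
    have e1 : slice (fun i k u => S i k (t j + u)) 0 = slice S (t j) := by rw [slice_shift, add_zero]
    have e2 : slice (fun i k u => S i k (t j + u)) (t (j + 1) - t j) = slice S (t (j + 1)) := by
      rw [slice_shift, add_sub_cancel]
    have h := (hstep j hjN (t (j + 1) - t j) _ (by linarith) le_rfl (by rw [e1]; exact hnode) hrun'
      (fun i k hk1 hk2 u hu => hM i k hk1 hk2 (t j + u) ⟨by linarith [hu.1], by linarith [hu.2]⟩)).2 rfl
    rw [e2] at h
    exact h

/-- **Mesh induction, hulls**: along a run on `[0,s]` from `Node 0` in the closed `M`-box, at every time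
`u ∈ [t j, t (j+1)] ∩ [0, s]` of a step `j < N` that has started (`t j < s`, or `t j ≤ s` with `u` a reached
node) the state lies in `Hull j`. [cite: Tao2016AveragedNS, §6.3–6.4 (statement shape); cell certificate format, mesh layer] -/
theorem hull_of_mesh (ht0 : t 0 = 0) (hmono : ∀ j, j < N → t j < t (j + 1))
    (hstep : ∀ j, j < N → StepCert 𝕊 ε₀ α Kb Ka Eb Et M t Node Hull j)
    {s : ℝ} {S : Fin m → ℤ → ℝ → ℝ} (hrun : WindowRun 𝕊 ε₀ α Kb Ka Eb Et s S) (h0 : Node 0 (slice S 0))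
    (hM : ∀ i k, -Kb ≤ k → k ≤ Ka → ∀ u ∈ Icc 0 s, |S i k u| ≤ M k)
    {j : ℕ} (hj : j < N) (htj : t j < s) {u : ℝ} (hu1 : t j ≤ u) (hu2 : u ≤ t (j + 1)) (hus : u ≤ s) :
    Hull j (slice S u) := by
  have htnn : ∀ j, j ≤ N → 0 ≤ t j := by
    intro j hj
    induction j with
    | zero => rw [ht0]
    | succ j ih => exact (ih (by omega)).trans (hmono j (by omega)).le
  have hj0 : 0 ≤ t j := htnn j hj.le
  have hnode := node_of_mesh ht0 hmono hstep hrun h0 hM j hj.le htj.le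
  -- run the step from `t j` for the clock `s' = min (t (j+1)) s - t j > 0`
  set s' : ℝ := min (t (j + 1)) s - t j with hs'
  have hs'0 : 0 < s' := by
    rw [hs']; have := hmono j hj; rw [lt_sub_iff_add_lt, zero_add, lt_min_iff]; exact ⟨this, htj⟩
  have hs'1 : s' ≤ t (j + 1) - t j := by rw [hs']; linarith [min_le_left (t (j + 1)) s]
  have hs's : t j + s' ≤ s := by rw [hs']; linarith [min_le_right (t (j + 1)) s]
  have hrun' : WindowRun 𝕊 ε₀ α Kb Ka Eb Et s' (fun i k u => S i k (t j + u)) :=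
    (hrun.shift (t₀ := t j) hj0).mono (by linarith)
  have e1 : slice (fun i k u => S i k (t j + u)) 0 = slice S (t j) := by rw [slice_shift, add_zero]
  have e2 : slice (fun i k u => S i k (t j + u)) (u - t j) = slice S u := by rw [slice_shift, add_sub_cancel]
  have h := (hstep j hj s' _ hs'0 hs'1 (by rw [e1]; exact hnode) hrun'
    (fun i k hk1 hk2 v hv => hM i k hk1 hk2 (t j + v) ⟨by linarith [hv.1], by linarith [hv.2]⟩)).1
    (u - t j) ⟨by linarith, by rw [hs', le_sub_iff_add_le, sub_add_cancel]; exact le_min hu2 hus⟩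
  rw [e2] at h
  exact h

/-- **THE TRAPPING CLAUSE `htrap` FROM A MESH CERTIFICATE**: mesh `0 = t 0 < … < t N` with `c ≤ t N`, the
fattened core inside `Node 0`, every step certified, every hull inside the OPEN `M`-box ⇒ the clause `htrap`
of `CertificateGlueOn.gapData₂On_of_windowCertificate`, verbatim (with `Eb`, `Et` the two edge bounds).
[cite: Tao2016AveragedNS, §6.3–6.4 Props. 6.4–6.5 (statement shape of a renormalisation certificate); cell certificate format, mesh layer] -/
theorem htrap_of_mesh {Core : (Fin m → ℤ → ℝ) → Prop} {w : ℤ → ℝ} {r c : ℝ}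
    (ht0 : t 0 = 0) (hmono : ∀ j, j < N → t j < t (j + 1)) (hc : c ≤ t N)
    (hstart : ∀ (z S₀ : Fin m → ℤ → ℝ), Core z →
      (∀ i k, -Kb ≤ k → k ≤ Ka → w k * |S₀ i k - z i k| ≤ r) → Node 0 S₀)
    (hstep : ∀ j, j < N → StepCert 𝕊 ε₀ α Kb Ka Eb Et M t Node Hull j)
    (hhull : ∀ j, j < N → ∀ y, Hull j y → ∀ i k, -Kb ≤ k → k ≤ Ka → |y i k| < M k) :
    ∀ (s : ℝ) (z : Fin m → ℤ → ℝ) (S : Fin m → ℤ → ℝ → ℝ), Core z → 0 < s → s ≤ c →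
      (∀ i k, -Kb ≤ k → k ≤ Ka → w k * |S i k 0 - z i k| ≤ r) →
      (∀ i k, -Kb ≤ k → k ≤ Ka → ∀ u ∈ Icc 0 s,
        HasDerivWithinAt (S i k) (quadTermOn 𝕊 ε₀ α S i k u) (Icc 0 s) u) →
      (∀ i, ContinuousOn (S i (-Kb - 1)) (Icc 0 s)) → (∀ i, ContinuousOn (S i (Ka + 1)) (Icc 0 s)) →
      (∀ i, ∀ u ∈ Icc 0 s, |S i (-Kb - 1) u| ≤ Eb) →
      (∀ i, ∀ u ∈ Icc 0 s, |S i (Ka + 1) u| ≤ Et) →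
      (∀ i k, -Kb ≤ k → k ≤ Ka → ∀ u ∈ Icc 0 s, |S i k u| ≤ M k) →
        ∀ i k, -Kb ≤ k → k ≤ Ka → ∀ u ∈ Icc 0 s, |S i k u| < M k := by
  intro s z S hz hs hsc hball hder hcb hct hbb hbt hM i k hk1 hk2 u hu
  have hrun : WindowRun 𝕊 ε₀ α Kb Ka Eb Et s S := ⟨hder, hcb, hct, hbb, hbt⟩
  have h0 : Node 0 (slice S 0) := hstart z (slice S 0) hz (by simpa [slice] using hball)
  -- the first mesh index `j` with `u ≤ t (j+1)`; it is `< N` since `u ≤ s ≤ c ≤ t N`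
  have hN : 0 < N := by
    rcases Nat.eq_zero_or_pos N with h | h
    · subst h; rw [ht0] at hc; linarith [hu.1]
    · exact h
  have hex : ∃ j, u ≤ t (j + 1) := ⟨N - 1, by rw [Nat.sub_add_cancel hN]; linarith [hu.2]⟩
  classical
  set j := Nat.find hex with hj
  have hju : u ≤ t (j + 1) := Nat.find_spec hex
  have hjN : j < N := by
    by_contra h
    have : N - 1 < j := by omega
    exact (Nat.find_min hex this) (by rw [Nat.sub_add_cancel hN]; linarith [hu.2])
  have htj : t j ≤ u := by
    rcases Nat.eq_zero_or_pos j with h | h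
    · rw [h, ht0]; exact hu.1
    · have := Nat.find_min hex (show j - 1 < j by omega)
      rw [Nat.sub_add_cancel h] at this
      push Not at this
      exact this.le
  by_cases hlt : t j < s
  · exact hhull j hjN _ (hull_of_mesh ht0 hmono hstep hrun h0 hM hjN hlt htj hju hu.2) i k hk1 hk2
  · -- `t j = u = s`: the time is the end node of step `j - 1`
    push Not at hlt
    have hjs : t j = s := le_antisymm (htj.trans hu.2) hlt
    have hus : u = s := le_antisymm hu.2 (hjs ▸ htj)
    have hj1 : 0 < j := by
      rcases Nat.eq_zero_or_pos j with h | h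
      · rw [h, ht0] at hjs; linarith
      · exact h
    have hj' : j - 1 < N := by omega
    have hprev : t (j - 1) < s := by
      have := hmono (j - 1) hj'; rw [Nat.sub_add_cancel hj1] at this; linarith
    have hu2 : u ≤ t (j - 1 + 1) := by rw [Nat.sub_add_cancel hj1]; linarith
    exact hhull (j - 1) hj' _
      (hull_of_mesh ht0 hmono hstep hrun h0 hM hj' hprev (by linarith [hmono (j - 1) hj', hu2]) hu2 hu.2)
      i k hk1 hk2

/-- **THE LANDING CLAUSE `hland` FROM A MESH CERTIFICATE WITH A SECTION CROSSING**: mesh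
`0 = t 0 < … < t (ℓ+1) ≤ c₀`, fattened core inside `Node 0`, steps `0 … ℓ` certified, a section functional
`sec` continuous along window runs with `sec < lev` on `Node ℓ` and `lev ≤ sec` on `Node (ℓ+1)`, and the
STATIC READOUT CLAUSES at every state of `Hull ℓ` on the section `{sec = lev}` ⇒ the clause `hland` of
`CertificateGlueOn.gapData₂On_of_windowCertificate`, verbatim (edge bounds `Eb`, `Et`, exit factor `Zx`).
The crossing time `τ₁ ∈ (t ℓ, t (ℓ+1)]` is chosen per trajectory by the intermediate value theorem.
[cite: Tao2016AveragedNS, §6.3–6.4 Props. 6.4–6.5 (statement shape of a renormalisation certificate; the readout at the crossing); cell certificate format, mesh layer] -/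
theorem hland_of_mesh {Core : (Fin m → ℤ → ℝ) → Prop} {w : ℤ → ℝ} {r ρ θ₀ σ c₀ Zx : ℝ} {i₀ : Fin m}
    {sec : (Fin m → ℤ → ℝ) → ℝ} {lev : ℝ} {ℓ : ℕ}
    (ht0 : t 0 = 0) (hmono : ∀ j, j < ℓ + 1 → t j < t (j + 1)) (hc₀ : t (ℓ + 1) ≤ c₀)
    (hstart : ∀ (z S₀ : Fin m → ℤ → ℝ), Core z →
      (∀ i k, -Kb ≤ k → k ≤ Ka → w k * |S₀ i k - z i k| ≤ r) → Node 0 S₀)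
    (hstep : ∀ j, j < ℓ + 1 → StepCert 𝕊 ε₀ α Kb Ka Eb Et M t Node Hull j)
    (hsec : ∀ (s : ℝ) (S : Fin m → ℤ → ℝ → ℝ), WindowRun 𝕊 ε₀ α Kb Ka Eb Et s S →
      ContinuousOn (fun u => sec (slice S u)) (Icc 0 s))
    (hbefore : ∀ y, Node ℓ y → sec y < lev) (hafter : ∀ y, Node (ℓ + 1) y → lev ≤ sec y)
    (hread : ∀ y, Hull ℓ y → sec y = lev →
      ∃ (a : ℝ) (z' : Fin m → ℤ → ℝ), 0 < a ∧ (1 + ε₀) ^ (-θ₀) ≤ a ∧ (1 + σ) * a ≤ |y i₀ 1| ∧ Core z' ∧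
        (∀ i k, -Kb ≤ k → k + 1 ≤ Ka → w k * |y i (1 + k) / a - z' i k| ≤ ρ * r) ∧
        (∀ (i : Fin m) (v : ℝ), |v| ≤ Et → w Ka * |v / a - z' i Ka| ≤ ρ * r) ∧
        (∀ i, |y i (-Kb)| ≤ a * Zx)) :
    ∀ (z : Fin m → ℤ → ℝ) (S : Fin m → ℤ → ℝ → ℝ), Core z →
      (∀ i k, -Kb ≤ k → k ≤ Ka → w k * |S i k 0 - z i k| ≤ r) →
      (∀ i k, -Kb ≤ k → k ≤ Ka → ∀ u ∈ Icc 0 c₀,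
        HasDerivWithinAt (S i k) (quadTermOn 𝕊 ε₀ α S i k u) (Icc 0 c₀) u) →
      (∀ i, ContinuousOn (S i (-Kb - 1)) (Icc 0 c₀)) → (∀ i, ContinuousOn (S i (Ka + 1)) (Icc 0 c₀)) →
      (∀ i, ∀ u ∈ Icc 0 c₀, |S i (-Kb - 1) u| ≤ Eb) →
      (∀ i, ∀ u ∈ Icc 0 c₀, |S i (Ka + 1) u| ≤ Et) →
      (∀ i k, -Kb ≤ k → k ≤ Ka → ∀ u ∈ Icc 0 c₀, |S i k u| ≤ M k) →
        ∃ (τ₁ a : ℝ) (z' : Fin m → ℤ → ℝ), 0 < τ₁ ∧ τ₁ ≤ c₀ ∧ 0 < a ∧ (1 + ε₀) ^ (-θ₀) ≤ a ∧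
          (1 + σ) * a ≤ |S i₀ 1 τ₁| ∧ Core z' ∧
          (∀ i k, -Kb ≤ k → k + 1 ≤ Ka → w k * |S i (1 + k) τ₁ / a - z' i k| ≤ ρ * r) ∧
          (∀ (i : Fin m) (v : ℝ), |v| ≤ Et → w Ka * |v / a - z' i Ka| ≤ ρ * r) ∧
          (∀ i, |S i (-Kb) τ₁| ≤ a * Zx) := by
  intro z S hz hball hder hcb hct hbb hbt hM
  have hrun : WindowRun 𝕊 ε₀ α Kb Ka Eb Et c₀ S := ⟨hder, hcb, hct, hbb, hbt⟩
  have h0 : Node 0 (slice S 0) := hstart z (slice S 0) hz (by simpa [slice] using hball)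
  have htnn : ∀ j, j ≤ ℓ + 1 → 0 ≤ t j := by
    intro j hj
    induction j with
    | zero => rw [ht0]
    | succ j ih => exact (ih (by omega)).trans (hmono j (by omega)).le
  have hℓ : ℓ < ℓ + 1 := Nat.lt_succ_self ℓ
  have htℓ : t ℓ < t (ℓ + 1) := hmono ℓ hℓ
  have htℓ0 : 0 ≤ t ℓ := htnn ℓ hℓ.le
  have htℓs : t ℓ < c₀ := lt_of_lt_of_le htℓ hc₀
  -- the two end nodes of the landing step
  have hnℓ := node_of_mesh ht0 hmono hstep hrun h0 hM ℓ hℓ.le htℓs.le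
  have hnℓ1 := node_of_mesh ht0 hmono hstep hrun h0 hM (ℓ + 1) le_rfl hc₀
  -- intermediate value theorem for `u ↦ sec (slice S u)` on `[t ℓ, t (ℓ+1)]`
  have hcont : ContinuousOn (fun u => sec (slice S u)) (Icc (t ℓ) (t (ℓ + 1))) :=
    (hsec c₀ S hrun).mono (Icc_subset_Icc htℓ0 hc₀)
  have hivt := intermediate_value_Icc htℓ.le hcont
  have hlev : lev ∈ Icc (sec (slice S (t ℓ))) (sec (slice S (t (ℓ + 1)))) :=
    ⟨(hbefore _ hnℓ).le, hafter _ hnℓ1⟩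
  obtain ⟨τ₁, hτ₁, hτ₁lev⟩ := hivt hlev
  have hτ₁ne : τ₁ ≠ t ℓ := by
    intro h; rw [h] at hτ₁lev; exact (hbefore _ hnℓ).ne hτ₁lev
  have hτ₁gt : t ℓ < τ₁ := lt_of_le_of_ne hτ₁.1 (Ne.symm hτ₁ne)
  -- the crossing state lies in `Hull ℓ`
  have hhull : Hull ℓ (slice S τ₁) :=
    hull_of_mesh ht0 hmono hstep hrun h0 hM hℓ htℓs hτ₁.1 hτ₁.2 (hτ₁.2.trans hc₀)
  obtain ⟨a, z', ha, haθ, haσ, hz', hmatch, htop, hexit⟩ := hread _ hhull hτ₁lev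
  exact ⟨τ₁, a, z', lt_of_le_of_lt htℓ0 hτ₁gt, hτ₁.2.trans hc₀, ha, haθ, by simpa [slice] using haσ, hz',
    by simpa [slice] using hmatch, htop, by simpa [slice] using hexit⟩

end CertificateGlueOn

end Summit.NavierStokesRegularity.NavierStokesRegularity.Theorems

end
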